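import Summits.Ventures.PercRepro.S2LPCore

/-!
# PercRepro — THE EXACT UPWARD AND CLOSURE INCIDENCES BY NULLITY CLASS (p2, gen 30; the level-5
coloop/closure LP, SUBCLAIM-S2 feeder)

The incidences «a rank-`b` `k`-set inside a `(k + 1)`-set» of `S1CoreLPIncidence`, counted EXACTLY: a
`(k + 1)`-set `S` of rank `b + 1` contains a rank-`b` `k`-subset `S ∖ x` exactly for its coloops `x` — `(k + 1) −
#core S` of them — and a `(k + 1)`-set of rank `b` exactly for its non-coloops — `#core S` of them. Grouping the
`(k + 1)`-sets by the size of their core gives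

  `(n − k)·m[k, b] = Σ_s (k + 1 − s)·c_ν[k + 1, s] + Σ_s s·c_{ν+1}[k + 1, s]`   (`ν = k − b`)

and the closure side `Σ_s s·c_{ν+1}[k + 1, s] ≤ (F − k)·m[k, b]` when every rank-`b` `k`-set has at most `F − k`
extensions of rank `b`. Nothing is claimed about any cell.

* `fibre_eq_coloopsOf`, `fibre_eq_core`, `ncard_incPairs_eq_sum`, `sum_rkSets_core_eq`,
  **`up_exact`**, **`closure_exact`**.
Axioms: standard.
-/

open scoped Matroid

namespace PercRepro

namespace S2LP

open Set Finset

variable {α : Type} {M : Matroid α} [M.Finite]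

/-- In a `(k + 1)`-set of rank `b + 1` the elements `x` with `ρ(S ∖ x) = b` are exactly the coloops. -/
theorem fibre_eq_coloopsOf {b : ℕ} {S : Set α} (hS : S ⊆ M.E) (hSb : M.eRk S = ((b + 1 : ℕ) : ℕ∞)) :
    {x ∈ S | M.eRk (S \ {x}) = (b : ℕ∞)} = coloopsOf M S := by
  ext x
  simp only [mem_setOf_eq, coloopsOf]
  constructor
  · rintro ⟨hx, h⟩
    refine ⟨hx, ?_⟩
    rw [h, hSb]; push_cast; rfl
  · rintro ⟨hx, h⟩
    refine ⟨hx, ?_⟩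
    rw [hSb] at h
    have hfin : M.eRk (S \ {x}) ≠ ⊤ := eRk_ne_top_of_finite' ((M.ground_finite.subset hS).subset sdiff_subset)
    obtain ⟨a, ha⟩ := ENat.ne_top_iff_exists.mp hfin
    rw [← ha] at h ⊢
    have : a + 1 = b + 1 := by exact_mod_cast h
    have : a = b := by omega
    rw [this]

omit [M.Finite] in
/-- In a `(k + 1)`-set of rank `b` the elements `x` with `ρ(S ∖ x) = b` are exactly the non-coloops: the core. -/
theorem fibre_eq_core {b : ℕ} {S : Set α} (hSb : M.eRk S = (b : ℕ∞)) :
    {x ∈ S | M.eRk (S \ {x}) = (b : ℕ∞)} = core M S := by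
  ext x
  simp only [mem_setOf_eq, core, coloopsOf, mem_sdiff, not_and]
  constructor
  · rintro ⟨hx, h⟩
    refine ⟨hx, fun _ h' => ?_⟩
    rw [h, hSb] at h'
    have : b + 1 = b := by exact_mod_cast h'
    omega
  · rintro ⟨hx, h⟩
    refine ⟨hx, ?_⟩
    have h' := h hx
    have hle : M.eRk (S \ {x}) ≤ M.eRk S := M.eRk_mono sdiff_subset
    have hge : M.eRk S ≤ M.eRk (S \ {x}) + 1 := by
      have := M.eRk_insert_le_add_one x (S \ {x})
      rwa [insert_sdiff_singleton, insert_eq_of_mem hx] at this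
    rw [hSb] at hle hge h'
    have hfin : M.eRk (S \ {x}) ≠ ⊤ := ne_top_of_le_ne_top (ENat.coe_ne_top b) hle
    obtain ⟨a, ha⟩ := ENat.ne_top_iff_exists.mp hfin
    rw [← ha] at hle hge h' ⊢
    have h1 : a ≤ b := by exact_mod_cast hle
    have h2 : b ≤ a + 1 := by exact_mod_cast hge
    have h3 : ¬ (a + 1 = b) := fun h => h' (by exact_mod_cast h)
    have : a = b := by omega
    rw [this]

/-- The `(k + 1)`-sets over which the incidences of `(k, b)` lie: ranks `b + 1` and `b`. -/
def topSets (M : Matroid α) (k b : ℕ) : Set (Set α) := S1.rkSets M (k + 1) (b + 1) ∪ S1.rkSets M (k + 1) b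

/-- `topSets` is finite. -/
theorem topSets_finite (k b : ℕ) : (topSets M k b).Finite :=
  (S1.rkSets_finite (k + 1) (b + 1)).union (S1.rkSets_finite (k + 1) b)

/-- Every incidence pair has its `(k + 1)`-set in `topSets`. -/
theorem snd_mem_topSets {k b : ℕ} {R : Set α × Set α} (hR : R ∈ S1.incPairs M k b) : R.2 ∈ topSets M k b := by
  obtain ⟨⟨hAE, hAk, hAb⟩, hSE, hS, hAS⟩ := hR
  have hSfin : R.2.Finite := M.ground_finite.subset hSE
  obtain ⟨x, -, hSeq⟩ := S1.eq_insert_of_subset_of_ncard hSfin hAk hS hAS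
  have hle : M.eRk R.2 ≤ ((b + 1 : ℕ) : ℕ∞) := by
    rw [hSeq]; push_cast; rw [← hAb]; exact M.eRk_insert_le_add_one x R.1
  have hge : (b : ℕ∞) ≤ M.eRk R.2 := by rw [← hAb]; exact M.eRk_mono hAS
  have hfin : M.eRk R.2 ≠ ⊤ := ne_top_of_le_ne_top (ENat.coe_ne_top _) hle
  obtain ⟨a, ha⟩ := ENat.ne_top_iff_exists.mp hfin
  rw [← ha] at hle hge
  have hle' : a ≤ b + 1 := by exact_mod_cast hle
  have hge' : b ≤ a := by exact_mod_cast hge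
  rcases Nat.lt_or_ge a (b + 1) with hlt | hge2
  · right
    refine ⟨hSE, hS, ?_⟩
    rw [← ha]; have : a = b := by omega
    rw [this]
  · left
    refine ⟨hSE, hS, ?_⟩
    rw [← ha]; have : a = b + 1 := by omega
    rw [this]

/-- **The incidence count as a sum over the `(k + 1)`-sets**: `#incPairs = Σ_{S ∈ topSets} #{x ∈ S | ρ(S ∖ x) = b}`. -/
theorem ncard_incPairs_eq_sum (k b : ℕ) :
    (S1.incPairs M k b).ncard =
      ∑ S ∈ (topSets_finite (M := M) k b).toFinset, {x ∈ S | M.eRk (S \ {x}) = (b : ℕ∞)}.ncard := by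
  have hTfin := topSets_finite (M := M) k b
  have hIfin := S1.incPairs_finite (M := M) k b
  have heq : S1.incPairs M k b = ⋃ S ∈ topSets M k b, {R ∈ S1.incPairs M k b | R.2 = S} := by
    ext R
    simp only [mem_iUnion, mem_setOf_eq, exists_prop]
    constructor
    · intro hR; exact ⟨R.2, snd_mem_topSets hR, hR, rfl⟩
    · rintro ⟨S, -, hR, -⟩; exact hR
  have hdisj : (topSets M k b).PairwiseDisjoint (fun S => {R ∈ S1.incPairs M k b | R.2 = S}) := by
    intro S _ S' _ hSS
    rw [Function.onFun, Set.disjoint_left]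
    rintro R ⟨-, h1⟩ ⟨-, h2⟩
    exact hSS (h1.symm.trans h2)
  rw [heq, hTfin.ncard_biUnion (fun S _ => hIfin.subset (fun _ hR => hR.1)) hdisj,
    finsum_mem_eq_finite_toFinset_sum _ hTfin]
  refine Finset.sum_congr rfl (fun S hS => ?_)
  rw [Finite.mem_toFinset] at hS
  have hSE : S ⊆ M.E := by
    rcases hS with h | h
    · exact h.1
    · exact h.1
  have hSk : S.ncard = k + 1 := by
    rcases hS with h | h
    · exact h.2.1
    · exact h.2.1
  rw [S1.fibre_incPairs_eq k b hSE hSk, InjOn.ncard_image (S1.injOn_sdiff_pair (M := M) S b)]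

/-- **Grouping a sum over the rank class `rkSets (k + 1) r` by the size of the core**: with `ν = k + 1 − r`,
`Σ_{S ∈ rkSets (k+1) r} g(#core S) = Σ_{s ≤ k + 1} g(s)·#nuSets (k + 1) ν s`. -/
theorem sum_rkSets_core_eq (k r : ℕ) (hr : r ≤ k + 1) (g : ℕ → ℕ) :
    ∑ S ∈ (S1.rkSets_finite (M := M) (k + 1) r).toFinset, g (core M S).ncard =
      ∑ s ∈ Finset.range (k + 2), g s * (nuSets M (k + 1) (k + 1 - r) s).ncard := by
  have hfin := S1.rkSets_finite (M := M) (k + 1) r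
  rw [← Finset.sum_fiberwise_of_maps_to (s := hfin.toFinset) (t := Finset.range (k + 2))
    (g := fun S => (core M S).ncard) (f := fun S => g (core M S).ncard) ?_]
  · refine Finset.sum_congr rfl (fun s _ => ?_)
    rw [Finset.sum_congr rfl (fun S hS => by
      rw [Finset.mem_filter] at hS
      rw [hS.2] : ∀ S ∈ hfin.toFinset.filter (fun S => (core M S).ncard = s), g (core M S).ncard = g s)]
    rw [Finset.sum_const, smul_eq_mul, mul_comm]
    congr 1
    rw [ncard_eq_toFinset_card (nuSets M (k + 1) (k + 1 - r) s) (nuSets_finite (k + 1) (k + 1 - r) s)]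
    congr 1
    ext S
    simp only [Finset.mem_filter, Finite.mem_toFinset, mem_nuSets]
    rw [show k + 1 - (k + 1 - r) = r by omega]
    rfl
  · intro S hS
    rw [Finite.mem_toFinset] at hS
    rw [Finset.mem_range]
    have := ncard_core_add_ncard_coloopsOf (M := M) hS.1
    have := hS.2.1
    omega

/-- **THE EXACT UPWARD INCIDENCE**: for `b ≤ k`, with `ν = k − b`,
`(n − k)·m[k, b] = Σ_{s ≤ k+1} (k + 1 − s)·#nuSets (k+1) ν s + Σ_{s ≤ k+1} s·#nuSets (k+1) (ν+1) s`. -/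
theorem up_exact (k b : ℕ) (hb : b ≤ k) :
    (M.E.ncard - k) * (S1.rkSets M k b).ncard =
      ∑ s ∈ Finset.range (k + 2), (k + 1 - s) * (nuSets M (k + 1) (k - b) s).ncard +
        ∑ s ∈ Finset.range (k + 2), s * (nuSets M (k + 1) (k - b + 1) s).ncard := by
  rw [← S1.ncard_incPairs, ncard_incPairs_eq_sum]
  have hdisj : Disjoint (S1.rkSets_finite (M := M) (k + 1) (b + 1)).toFinset
      (S1.rkSets_finite (M := M) (k + 1) b).toFinset := by
    rw [Finset.disjoint_left]
    intro S h1 h2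
    rw [Finite.mem_toFinset] at h1 h2
    have := h1.2.2.symm.trans h2.2.2
    have : b + 1 = b := by exact_mod_cast this
    omega
  have hunion : (topSets_finite (M := M) k b).toFinset =
      (S1.rkSets_finite (M := M) (k + 1) (b + 1)).toFinset ∪ (S1.rkSets_finite (M := M) (k + 1) b).toFinset := by
    ext S
    simp only [Finite.mem_toFinset, Finset.mem_union, topSets, mem_union]
  rw [hunion, Finset.sum_union hdisj]
  congr 1
  · rw [Finset.sum_congr rfl (fun S hS => by
      rw [Finite.mem_toFinset] at hS
      rw [fibre_eq_coloopsOf hS.1 hS.2.2] :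
        ∀ S ∈ (S1.rkSets_finite (M := M) (k + 1) (b + 1)).toFinset,
          {x ∈ S | M.eRk (S \ {x}) = (b : ℕ∞)}.ncard = (coloopsOf M S).ncard)]
    rw [Finset.sum_congr rfl (fun S hS => by
      rw [Finite.mem_toFinset] at hS
      have := ncard_core_add_ncard_coloopsOf (M := M) hS.1
      rw [hS.2.1] at this
      show (coloopsOf M S).ncard = k + 1 - (core M S).ncard
      omega :
        ∀ S ∈ (S1.rkSets_finite (M := M) (k + 1) (b + 1)).toFinset,
          (coloopsOf M S).ncard = (fun t => k + 1 - t) (core M S).ncard)]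
    rw [sum_rkSets_core_eq k (b + 1) (by omega) (fun t => k + 1 - t)]
    rw [show k + 1 - (b + 1) = k - b by omega]
  · rw [Finset.sum_congr rfl (fun S hS => by
      rw [Finite.mem_toFinset] at hS
      rw [fibre_eq_core hS.2.2] :
        ∀ S ∈ (S1.rkSets_finite (M := M) (k + 1) b).toFinset,
          {x ∈ S | M.eRk (S \ {x}) = (b : ℕ∞)}.ncard = (fun t => t) (core M S).ncard)]
    rw [sum_rkSets_core_eq k b (by omega) (fun t => t)]
    rw [show k + 1 - b = k - b + 1 by omega]

/-- **THE EXACT CLOSURE INCIDENCE**: for `b ≤ k`, if every rank-`b` `k`-set has at most `f` extensions of rank `b`,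
then `Σ_{s ≤ k+1} s·#nuSets (k+1) (k − b + 1) s ≤ f·m[k, b]`. -/
theorem closure_exact (k b f : ℕ) (hb : b ≤ k)
    (hhi : ∀ A ⊆ M.E, A.ncard = k → M.eRk A = (b : ℕ∞) →
      {x ∈ M.E \ A | M.eRk (insert x A) = (b : ℕ∞)}.ncard ≤ f) :
    ∑ s ∈ Finset.range (k + 2), s * (nuSets M (k + 1) (k - b + 1) s).ncard ≤ f * (S1.rkSets M k b).ncard := by
  have hIfin := S1.incPairs_finite (M := M) k b
  set X := {R ∈ S1.incPairs M k b | R.2 ∈ S1.rkSets M (k + 1) b} with hXdef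
  have hXfin : X.Finite := hIfin.subset (fun _ hR => hR.1)
  -- the exact count of `X` over the rank-`b` `(k + 1)`-sets
  have hXeq : X.ncard = ∑ s ∈ Finset.range (k + 2), s * (nuSets M (k + 1) (k - b + 1) s).ncard := by
    have hfin := S1.rkSets_finite (M := M) (k + 1) b
    have heq : X = ⋃ S ∈ S1.rkSets M (k + 1) b, {R ∈ S1.incPairs M k b | R.2 = S} := by
      ext R
      simp only [hXdef, mem_iUnion, mem_setOf_eq, exists_prop]
      constructor
      · rintro ⟨hR, hS⟩; exact ⟨R.2, hS, hR, rfl⟩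
      · rintro ⟨S, hS, hR, rfl⟩; exact ⟨hR, hS⟩
    have hdisj : (S1.rkSets M (k + 1) b).PairwiseDisjoint (fun S => {R ∈ S1.incPairs M k b | R.2 = S}) := by
      intro S _ S' _ hSS
      rw [Function.onFun, Set.disjoint_left]
      rintro R ⟨-, h1⟩ ⟨-, h2⟩
      exact hSS (h1.symm.trans h2)
    rw [heq, hfin.ncard_biUnion (fun S _ => hIfin.subset (fun _ hR => hR.1)) hdisj,
      finsum_mem_eq_finite_toFinset_sum _ hfin]
    rw [Finset.sum_congr rfl (fun S hS => by
      rw [Finite.mem_toFinset] at hS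
      rw [S1.fibre_incPairs_eq k b hS.1 hS.2.1, InjOn.ncard_image (S1.injOn_sdiff_pair (M := M) S b),
        fibre_eq_core hS.2.2] :
        ∀ S ∈ hfin.toFinset, {R ∈ S1.incPairs M k b | R.2 = S}.ncard = (fun t => t) (core M S).ncard)]
    rw [sum_rkSets_core_eq k b (by omega) (fun t => t), show k + 1 - b = k - b + 1 by omega]
  -- the upper bound over the rank-`b` `k`-sets
  have hup : X.ncard ≤ f * (S1.rkSets M k b).ncard := by
    refine S1.ncard_le_mul_of_fibres (S1.rkSets_finite k b) (fun A => {R ∈ X | R.1 = A}) ?_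
      (fun A _ => hXfin.subset (fun _ hR => hR.1)) f ?_
    · rintro R hR
      rw [mem_iUnion₂]
      exact ⟨R.1, hR.1.1, hR, rfl⟩
    · rintro A ⟨hAE, hAk, hAb⟩
      have hsub : {R ∈ X | R.1 = A} ⊆ (fun x => (A, insert x A)) '' {x ∈ M.E \ A | M.eRk (insert x A) = (b : ℕ∞)} := by
        rintro ⟨A', S⟩ ⟨⟨⟨-, hSE, hS, hAS⟩, -, -, hSb⟩, hAA⟩
        have hAA' : A' = A := hAA
        subst hAA'
        obtain ⟨x, hx, rfl⟩ := S1.eq_insert_of_subset_of_ncard (M.ground_finite.subset hSE) hAk hS hAS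
        exact ⟨x, ⟨⟨hSE hx.1, hx.2⟩, hSb⟩, rfl⟩
      refine (ncard_le_ncard hsub ((M.ground_finite.subset sdiff_subset |>.subset (fun _ h => h.1)).image _)).trans ?_
      exact (ncard_image_le (M.ground_finite.subset sdiff_subset |>.subset (fun _ h => h.1))).trans (hhi A hAE hAk hAb)
  rw [← hXeq]
  exact hup

end S2LP

end PercRepro
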